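import Literature.Probability.Divergences.FDivergence
import Mathlib.Analysis.SpecialFunctions.Pow.Asymptotics
import Mathlib.Analysis.SpecialFunctions.Log.ENNRealLog
import Mathlib.Analysis.Convex.SpecificFunctions.Pow
import HarnessLib

/-!
# The power (Hellinger) family of `f`-divergences and Rényi divergences

Topic `Literature/Probability/Divergences`; companion of `FDivergence.lean` (definition item
`defn-fDiv`: "special cases wanted as abbrevs: Rényi/Hellinger family").

## Contents

* `hellingerFun a x = (x ^ a - 1 - a (x - 1)) / (a - 1)` — the power generator of order
  `a ∈ (0,1) ∪ (1,∞)`: the generator `sign(a-1) (x^a - 1)` of [PolyanskiyWu2024, Def. 7.24]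
  divided by `|a - 1|` and normalised by its tangent at `1` (licensed by
  [PolyanskiyWu2024, Prop. 7.2 (6)]: generators differing by `c (x - 1)` give the same divergence
  of probability measures), so that it is NONNEGATIVE and convex on `[0, ∞)` (proved:
  `hellingerFun_nonneg`, `convexOn_hellingerFun`), vanishes at `1`, equals `1` at `0`, equals
  `chiSqFun` at `a = 2`, `sqHellingerFun` at `a = 1/2`, and tends to `klFun` as `a → 1`; slopes
  at infinity `derivAtTop (hellingerFun a) = a / (1 - a)` for `a < 1` and `= ∞` for `a > 1`
  (proved).
* `hellingerDiv a μ ν = fDiv (hellingerFun a) μ ν` — on pairs of probability measures this is the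
  Hellinger divergence `H_a = (∫ p^a q^{1-a} - 1) / (a - 1)` of the literature.
* `hellingerIntegral a μ ν = ∫ p^a q^{1-a} dλ` with the conventions of
  [VanervenHarremoes2014, Def. 2] (`0/0 = 0`, `x/0 = ∞`), and the **Rényi divergence**
  `renyiDiv a μ ν = (a - 1)⁻¹ log ∫ p^a q^{1-a}` of a simple order `a ∈ (0,1) ∪ (1,∞)`
  ([VanervenHarremoes2014, Def. 2]; [PolyanskiyWu2024, Def. 7.24]), extended by Mathlib's `klDiv`
  at `a = 1` ([VanervenHarremoes2014, Def. 3 and Thm. 5]).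

## Design

Values in `ℝ≥0∞` as in `FDivergence.lean`; `renyiDiv` is computed in `EReal`
(`(a - 1)⁻¹ * ENNReal.log (hellingerIntegral a μ ν)`) and mapped back by `EReal.toENNReal` — for
probability measures the product is already nonnegative (`a < 1`: integral `≤ 1`, `log ≤ 0`;
`a > 1`: integral `≥ 1`), and it is `∞` exactly when `μ ⟂ ν` (`a < 1`, `log 0 = -∞` times a
negative number) resp. when the Hellinger integral is infinite (`a > 1`). Orders `a ≤ 0`, `a = ∞`
and non-probability arguments are outside the intended domain (junk values). PROVED link
between the two readings ([PolyanskiyWu2024, Def. 7.24]: "`E_Q[(dP/dQ)^λ]` is formally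
understood as `sign(λ-1) D_f(P‖Q) + 1`"): for probability measures
`hellingerIntegral a μ ν + (1 - a) hellingerDiv a μ ν = 1` (`0 < a < 1`) and
`hellingerIntegral a μ ν = 1 + (a - 1) hellingerDiv a μ ν` (`a > 1`). Not here: monotonicity
in the order and the `a → 1` limit ([VanervenHarremoes2014, Thms. 3, 5]).
-/

noncomputable section

open _root_.MeasureTheory _root_.InformationTheory Filter Set
open scoped ENNReal NNReal Topology

namespace Literature.Probability.Divergences

variable {α : Type*} [MeasurableSpace α]

/-! ### The power (Hellinger) generators -/

/-- The **power (Hellinger-type) generator of order `a`**, `a ∈ (0,1) ∪ (1,∞)`: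
`hellingerFun a x = (x ^ a - 1 - a (x - 1)) / (a - 1)` — the generator `sign(a-1)(x^a - 1)` of
the source divided by `|a - 1|` and normalised by its tangent at `1` (so that it is `≥ 0`,
convex, vanishes at `1`, takes the value `1` at `0`, and tends to `klFun` as `a → 1`); on pairs of
probability measures `fDiv (hellingerFun a)` is the Hellinger divergence
`H_a = (∫ p^a q^{1-a} - 1) / (a - 1)`. [cite: PolyanskiyWu2024, Def. 7.24 with Prop. 7.2 (6)] -/
def hellingerFun (a : ℝ) (x : ℝ) : ℝ := (x ^ a - 1 - a * (x - 1)) / (a - 1)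

/-- Unfolding `hellingerFun`. [folklore] -/
theorem hellingerFun_apply (a x : ℝ) :
    hellingerFun a x = (x ^ a - 1 - a * (x - 1)) / (a - 1) := rfl

/-- `hellingerFun a 1 = 0`. [folklore] -/
@[simp] theorem hellingerFun_one (a : ℝ) : hellingerFun a 1 = 0 := by
  simp [hellingerFun]

/-- `hellingerFun a 0 = 1` (`a ≠ 0, 1`): the mass of `ν` where `dμ/dν = 0` counts fully.
[folklore] -/
theorem hellingerFun_zero {a : ℝ} (ha : a ≠ 0) (ha1 : a ≠ 1) : hellingerFun a 0 = 1 := by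
  rw [hellingerFun_apply, Real.zero_rpow ha]
  field_simp [sub_ne_zero.mpr ha1]
  ring

/-- The power generators are nonnegative on `[0, ∞)` (Bernoulli's inequality: `x ^ a` lies above
its tangent at `1` for `a > 1`, below it for `0 < a < 1`). [folklore] -/
theorem hellingerFun_nonneg {a : ℝ} (ha0 : 0 < a) (ha1 : a ≠ 1) {x : ℝ} (hx : 0 ≤ x) :
    0 ≤ hellingerFun a x := by
  rw [hellingerFun_apply]
  have hs : -1 ≤ x - 1 := by linarith
  rcases lt_or_gt_of_ne ha1 with ha | ha
  · have h := rpow_one_add_le_one_add_mul_self hs ha0.le ha.le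
    rw [add_sub_cancel] at h
    exact div_nonneg_of_nonpos (by linarith) (by linarith)
  · have h := one_add_mul_self_le_rpow_one_add hs ha.le
    rw [add_sub_cancel] at h
    exact div_nonneg (by linarith) (by linarith)

/-- The power generators are measurable. [folklore] -/
@[fun_prop]
theorem measurable_hellingerFun (a : ℝ) : Measurable (hellingerFun a) := by
  unfold hellingerFun
  fun_prop

/-- The power generators are convex on `[0, ∞)` for every order `a > 0`, `a ≠ 1`. [folklore] -/
theorem convexOn_hellingerFun {a : ℝ} (ha0 : 0 < a) (ha1 : a ≠ 1) :
    ConvexOn ℝ (Ici 0) (hellingerFun a) := by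
  rcases lt_or_gt_of_ne ha1 with ha | ha
  · -- `a < 1`: `hellingerFun a = (1 - a)⁻¹ • (-(x ^ a) + (a x + (1 - a)))`, `x ^ a` concave
    have h := (((Real.concaveOn_rpow ha0.le ha.le).neg).add
      (convexOn_affine a (1 - a) (convex_Ici 0))).smul (inv_nonneg.mpr (sub_nonneg.mpr ha.le))
    refine h.congr fun x _ => ?_
    simp only [hellingerFun_apply, Pi.add_apply, Pi.neg_apply, smul_eq_mul]
    field_simp [(sub_pos.mpr ha).ne', (sub_neg.mpr ha).ne]
    ring
  · -- `a > 1`: `hellingerFun a = (a - 1)⁻¹ • (x ^ a + (-a x + (a - 1)))`, `x ^ a` convex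
    have h := ((convexOn_rpow ha.le).add (convexOn_affine (-a) (a - 1) (convex_Ici 0))).smul
      (inv_nonneg.mpr (sub_nonneg.mpr ha.le))
    refine h.congr fun x _ => ?_
    simp only [hellingerFun_apply, Pi.add_apply, smul_eq_mul]
    field_simp [(sub_pos.mpr ha).ne']
    ring

/-- Slope at infinity of the power generator of order `a < 1`: `a / (1 - a)` (finite: for
`a ∈ (0, 1)` these divergences charge the `ν`-singular mass of `μ` at the finite rate `a / (1 - a)`;
for `a ≤ 0` the value is truncated to `0`). [folklore] -/
theorem derivAtTop_hellingerFun_of_lt_one {a : ℝ} (ha : a < 1) :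
    derivAtTop (hellingerFun a) = ENNReal.ofReal (a / (1 - a)) := by
  refine derivAtTop_of_tendsto ?_
  have h1 : Tendsto (fun x : ℝ => x ^ (-(1 - a))) atTop (𝓝 0) :=
    tendsto_rpow_neg_atTop (by linarith)
  have h : Tendsto (fun x : ℝ => (x ^ (-(1 - a)) - x⁻¹ - a + a * x⁻¹) / (a - 1)) atTop
      (𝓝 ((0 - 0 - a + a * 0) / (a - 1))) :=
    (((h1.sub tendsto_inv_atTop_zero).sub_const a).add
      (tendsto_inv_atTop_zero.const_mul a)).div_const _
  have ha1 : a - 1 ≠ 0 := (sub_neg.mpr ha).ne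
  have ha1' : 1 - a ≠ 0 := (sub_pos.mpr ha).ne'
  have hlim : (0 - 0 - a + a * 0) / (a - 1) = a / (1 - a) := by
    field_simp
    ring
  rw [hlim] at h
  refine h.congr' ?_
  filter_upwards [eventually_gt_atTop 0] with x hx
  rw [hellingerFun_apply, show -(1 - a) = a - 1 by ring, Real.rpow_sub_one hx.ne']
  field_simp
  ring

/-- Slope at infinity of the power generator of order `a > 1`: `∞` (superlinear). [folklore] -/
theorem derivAtTop_hellingerFun_of_one_lt {a : ℝ} (ha : 1 < a) :
    derivAtTop (hellingerFun a) = ∞ := by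
  refine derivAtTop_of_tendsto_atTop ?_
  have h1 : Tendsto (fun x : ℝ => x ^ (a - 1)) atTop atTop := tendsto_rpow_atTop (by linarith)
  have h : Tendsto (fun x : ℝ => (x ^ (a - 1) + (-x⁻¹ - a + a * x⁻¹)) / (a - 1)) atTop atTop := by
    refine Tendsto.atTop_div_const (by linarith) ?_
    exact h1.atTop_add
      (((tendsto_inv_atTop_zero.neg).sub_const a).add (tendsto_inv_atTop_zero.const_mul a))
  refine h.congr' ?_
  filter_upwards [eventually_gt_atTop 0] with x hx
  rw [hellingerFun_apply, Real.rpow_sub_one hx.ne']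
  have ha1 : a - 1 ≠ 0 := (sub_pos.mpr ha).ne'
  field_simp
  ring

/-- The **Hellinger divergence of order `a`** (`a ∈ (0,1) ∪ (1,∞)`) as an `f`-divergence,
`H_a(μ ‖ ν) = fDiv (hellingerFun a) μ ν`; `χ²`-like for `a = 2` (`hellingerFun 2 = chiSqFun`).
[cite: PolyanskiyWu2024, Def. 7.24 with Prop. 7.2 (6)] -/
abbrev hellingerDiv (a : ℝ) (μ ν : Measure α) : ℝ≥0∞ := fDiv (hellingerFun a) μ ν

/-- `hellingerFun 2 = chiSqFun`. [folklore] -/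
theorem hellingerFun_two : hellingerFun 2 = chiSqFun := by
  ext x
  rw [hellingerFun_apply, chiSqFun_apply, show (2 : ℝ) = ((2 : ℕ) : ℝ) by norm_num,
    Real.rpow_natCast]
  ring

/-- At order `1/2` the power generator is the squared-Hellinger generator `(1 - √x)²`
(on `[0, ∞)`), so `hellingerDiv (1/2)` is the squared Hellinger distance `sqHellingerDiv`.
[folklore] -/
theorem hellingerFun_half {x : ℝ} (hx : 0 ≤ x) : hellingerFun (1 / 2) x = sqHellingerFun x := by
  rw [hellingerFun_apply, sqHellingerFun_apply, Real.sqrt_eq_rpow]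
  have h : (x ^ (1 / 2 : ℝ)) ^ 2 = x := by
    rw [← Real.sqrt_eq_rpow, Real.sq_sqrt hx]
  linear_combination (norm := skip) (-1 : ℝ) * h
  field_simp
  ring

/-! ### Hellinger integrals and Rényi divergences -/

/-- The **Hellinger integral** `∫ p^a q^{1-a} dλ` of order `a > 0`, `a ≠ 1`, with the conventions
of the source: for `a < 1` it is `∫ (dμ/dν)^a dν` (the set `{q = 0}` does not contribute), for
`a > 1` one reads `p^a q^{1-a} = p^a / q^{a-1}` with `x / 0 = ∞`, so the integral is `∞` as soon
as `μ` has a `ν`-singular part. [cite: VanervenHarremoes2014, Def. 2] -/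
def hellingerIntegral (a : ℝ) (μ ν : Measure α) : ℝ≥0∞ :=
  (∫⁻ x, (μ.rnDeriv ν x) ^ a ∂ν) + (if 1 < a then ∞ * μ.singularPart ν univ else 0)

/-- For `μ ≪ ν` the Hellinger integral is `∫ (dμ/dν)^a dν`. [cite: VanervenHarremoes2014, §II-A] -/
theorem hellingerIntegral_of_ac {a : ℝ} {μ ν : Measure α} (h : μ ≪ ν) :
    hellingerIntegral a μ ν = ∫⁻ x, (μ.rnDeriv ν x) ^ a ∂ν := by
  rw [hellingerIntegral, Measure.singularPart_eq_zero_of_ac h]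
  simp

/-- For `a < 1` the Hellinger integral is `∫ (dμ/dν)^a dν` (no singular contribution).
[cite: VanervenHarremoes2014, §II-A] -/
theorem hellingerIntegral_of_lt_one {a : ℝ} (ha : a < 1) (μ ν : Measure α) :
    hellingerIntegral a μ ν = ∫⁻ x, (μ.rnDeriv ν x) ^ a ∂ν := by
  rw [hellingerIntegral, if_neg (not_lt.mpr ha.le), add_zero]

/-- Pointwise identity behind `hellingerIntegral_add_mul_hellingerDiv`: for `0 < a < 1` and
finite `r`, `(1 - a) · hellingerFun a r + r ^ a = a r + (1 - a)` in `ℝ≥0∞`. [folklore] -/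
theorem ofReal_mul_hellingerFun_add_rpow {a : ℝ} (ha0 : 0 < a) (ha : a < 1) {r : ℝ≥0∞}
    (hr : r ≠ ∞) :
    ENNReal.ofReal (1 - a) * ENNReal.ofReal (hellingerFun a r.toReal) + r ^ a
      = ENNReal.ofReal a * r + ENNReal.ofReal (1 - a) := by
  set t := r.toReal with ht_def
  have ht : 0 ≤ t := ENNReal.toReal_nonneg
  have hr' : r = ENNReal.ofReal t := (ENNReal.ofReal_toReal hr).symm
  have h1a : 0 ≤ 1 - a := sub_nonneg.mpr ha.le
  rw [hr', ENNReal.ofReal_rpow_of_nonneg ht ha0.le, ← ENNReal.ofReal_mul h1a,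
    ← ENNReal.ofReal_add (mul_nonneg h1a (hellingerFun_nonneg ha0 ha.ne ht))
      (Real.rpow_nonneg ht a),
    ← ENNReal.ofReal_mul ha0.le, ← ENNReal.ofReal_add (mul_nonneg ha0.le ht) h1a]
  congr 1
  rw [hellingerFun_apply]
  field_simp [(sub_neg.mpr ha).ne]
  ring

/-- Pointwise identity behind `hellingerIntegral_eq_one_add_mul_hellingerDiv`: for `1 < a` and
finite `r`, `r ^ a + (a - 1) = (a - 1) · hellingerFun a r + a r` in `ℝ≥0∞`. [folklore] -/
theorem rpow_add_ofReal_eq_mul_hellingerFun {a : ℝ} (ha : 1 < a) {r : ℝ≥0∞} (hr : r ≠ ∞) :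
    r ^ a + ENNReal.ofReal (a - 1)
      = ENNReal.ofReal (a - 1) * ENNReal.ofReal (hellingerFun a r.toReal)
        + ENNReal.ofReal a * r := by
  set t := r.toReal with ht_def
  have ht : 0 ≤ t := ENNReal.toReal_nonneg
  have hr' : r = ENNReal.ofReal t := (ENNReal.ofReal_toReal hr).symm
  have ha1 : 0 ≤ a - 1 := sub_nonneg.mpr ha.le
  have ha0 : 0 < a := by linarith
  rw [hr', ENNReal.ofReal_rpow_of_nonneg ht ha0.le,
    ← ENNReal.ofReal_add (Real.rpow_nonneg ht a) ha1, ← ENNReal.ofReal_mul ha1,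
    ← ENNReal.ofReal_mul ha0.le,
    ← ENNReal.ofReal_add (mul_nonneg ha1 (hellingerFun_nonneg ha0 ha.ne' ht))
      (mul_nonneg ha0.le ht)]
  congr 1
  rw [hellingerFun_apply]
  field_simp [(sub_pos.mpr ha).ne']
  ring

/-- Total mass splits into the absolutely continuous and the singular part:
`∫ (dμ/dν) dν + μ^⊥(univ) = μ(univ)`. [folklore] -/
theorem lintegral_rnDeriv_add_singularPart (μ ν : Measure α) [μ.HaveLebesgueDecomposition ν] :
    ∫⁻ x, μ.rnDeriv ν x ∂ν + μ.singularPart ν univ = μ univ := by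
  have h1 : ν.withDensity (μ.rnDeriv ν) univ + μ.singularPart ν univ = μ univ := by
    rw [← Measure.add_apply, Measure.rnDeriv_add_singularPart]
  rwa [withDensity_apply _ MeasurableSet.univ, Measure.restrict_univ] at h1

/-- **The Hellinger integral is an affine function of the power divergence, `0 < a < 1`**: for
probability measures, `∫ p^a q^{1-a} + (1 - a) · H_a(μ ‖ ν) = 1`, i.e.
`∫ p^a q^{1-a} = 1 + (a - 1) H_a` — the reading "`E_Q[(dP/dQ)^a]` is formally understood as
`sign(a-1) D_f(P‖Q) + 1`" of the source, here a theorem (including the `ν`-singular part of `μ`,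
charged at rate `a / (1 - a)` by `H_a` and not at all by the integral).
[cite: PolyanskiyWu2024, Def. 7.24] -/
theorem hellingerIntegral_add_mul_hellingerDiv {a : ℝ} (ha0 : 0 < a) (ha : a < 1)
    (μ ν : Measure α) [IsProbabilityMeasure μ] [IsProbabilityMeasure ν] :
    hellingerIntegral a μ ν + ENNReal.ofReal (1 - a) * hellingerDiv a μ ν = 1 := by
  have h1a : 0 ≤ 1 - a := sub_nonneg.mpr ha.le
  have hmeasH : Measurable fun x => ENNReal.ofReal (hellingerFun a (μ.rnDeriv ν x).toReal) :=
    ((measurable_hellingerFun a).comp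
        (Measure.measurable_rnDeriv μ ν).ennreal_toReal).ennreal_ofReal
  have hmeasP : Measurable fun x => μ.rnDeriv ν x ^ a :=
    (Measure.measurable_rnDeriv μ ν).pow_const a
  rw [hellingerIntegral_of_lt_one ha, hellingerDiv, fDiv_def, derivAtTop_hellingerFun_of_lt_one ha,
    mul_add, ← mul_assoc, ← ENNReal.ofReal_mul h1a,
    show (1 - a) * (a / (1 - a)) = a by field_simp [(sub_pos.mpr ha).ne'],
    ← lintegral_const_mul _ hmeasH, ← add_assoc, ← lintegral_add_left hmeasP]
  have hpt : ∀ᵐ x ∂ν, μ.rnDeriv ν x ^ a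
      + ENNReal.ofReal (1 - a) * ENNReal.ofReal (hellingerFun a (μ.rnDeriv ν x).toReal)
      = ENNReal.ofReal a * μ.rnDeriv ν x + ENNReal.ofReal (1 - a) := by
    filter_upwards [Measure.rnDeriv_lt_top μ ν] with x hx
    rw [add_comm]
    exact ofReal_mul_hellingerFun_add_rpow ha0 ha hx.ne
  rw [lintegral_congr_ae hpt, lintegral_add_right _ measurable_const,
    lintegral_const_mul _ (Measure.measurable_rnDeriv μ ν), lintegral_const, measure_univ, mul_one]
  calc ENNReal.ofReal a * ∫⁻ x, μ.rnDeriv ν x ∂ν + ENNReal.ofReal (1 - a)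
        + ENNReal.ofReal a * μ.singularPart ν univ
      = ENNReal.ofReal a * (∫⁻ x, μ.rnDeriv ν x ∂ν + μ.singularPart ν univ)
        + ENNReal.ofReal (1 - a) := by ring
    _ = 1 := by
      rw [lintegral_rnDeriv_add_singularPart, measure_univ, mul_one,
        ← ENNReal.ofReal_add ha0.le h1a, add_sub_cancel, ENNReal.ofReal_one]

/-- **The Hellinger integral is an affine function of the power divergence, `a > 1`**: for
probability measures, `∫ p^a q^{1-a} = 1 + (a - 1) · H_a(μ ‖ ν)` (both sides are `∞` unless
`μ ≪ ν`). [cite: PolyanskiyWu2024, Def. 7.24] -/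
theorem hellingerIntegral_eq_one_add_mul_hellingerDiv {a : ℝ} (ha : 1 < a)
    (μ ν : Measure α) [IsProbabilityMeasure μ] [IsProbabilityMeasure ν] :
    hellingerIntegral a μ ν = 1 + ENNReal.ofReal (a - 1) * hellingerDiv a μ ν := by
  have ha1 : 0 ≤ a - 1 := sub_nonneg.mpr ha.le
  have hc : ENNReal.ofReal (a - 1) ≠ ∞ := ENNReal.ofReal_ne_top
  by_cases hac : μ ≪ ν
  · have hmeasH : Measurable fun x => ENNReal.ofReal (hellingerFun a (μ.rnDeriv ν x).toReal) :=
      ((measurable_hellingerFun a).comp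
        (Measure.measurable_rnDeriv μ ν).ennreal_toReal).ennreal_ofReal
    have hmeasP : Measurable fun x => μ.rnDeriv ν x ^ a :=
      (Measure.measurable_rnDeriv μ ν).pow_const a
    rw [hellingerIntegral_of_ac hac, hellingerDiv, fDiv_of_ac hac]
    have hpt : ∀ᵐ x ∂ν, μ.rnDeriv ν x ^ a + ENNReal.ofReal (a - 1)
        = ENNReal.ofReal (a - 1) * ENNReal.ofReal (hellingerFun a (μ.rnDeriv ν x).toReal)
          + ENNReal.ofReal a * μ.rnDeriv ν x := by
      filter_upwards [Measure.rnDeriv_lt_top μ ν] with x hx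
      exact rpow_add_ofReal_eq_mul_hellingerFun ha hx.ne
    have key : ∫⁻ x, μ.rnDeriv ν x ^ a ∂ν + ENNReal.ofReal (a - 1)
        = ENNReal.ofReal (a - 1) * ∫⁻ x, ENNReal.ofReal (hellingerFun a (μ.rnDeriv ν x).toReal) ∂ν
          + ENNReal.ofReal a := by
      calc ∫⁻ x, μ.rnDeriv ν x ^ a ∂ν + ENNReal.ofReal (a - 1)
          = ∫⁻ x, μ.rnDeriv ν x ^ a + ENNReal.ofReal (a - 1) ∂ν := by
            rw [lintegral_add_right _ measurable_const, lintegral_const, measure_univ, mul_one]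
        _ = ∫⁻ x, ENNReal.ofReal (a - 1) * ENNReal.ofReal (hellingerFun a (μ.rnDeriv ν x).toReal)
              + ENNReal.ofReal a * μ.rnDeriv ν x ∂ν := lintegral_congr_ae hpt
        _ = _ := by
            rw [lintegral_add_left (hmeasH.const_mul _), lintegral_const_mul _ hmeasH,
              lintegral_const_mul _ (Measure.measurable_rnDeriv μ ν), Measure.lintegral_rnDeriv hac,
              measure_univ, mul_one]
    have hsplit : ENNReal.ofReal a = 1 + ENNReal.ofReal (a - 1) := by
      rw [← ENNReal.ofReal_one, ← ENNReal.ofReal_add zero_le_one ha1]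
      congr 1
      ring
    rw [hsplit, ← add_assoc, add_comm (ENNReal.ofReal (a - 1) * _) 1] at key
    exact (ENNReal.add_left_inj hc).mp key
  · have hs : μ.singularPart ν univ ≠ 0 := by
      rw [ne_eq, Measure.measure_univ_eq_zero, Measure.singularPart_eq_zero]
      exact hac
    have h0 : ENNReal.ofReal (a - 1) ≠ 0 := by
      rw [ne_eq, ENNReal.ofReal_eq_zero, not_le]
      exact sub_pos.mpr ha
    rw [hellingerIntegral, if_pos ha, ENNReal.top_mul hs, add_top, hellingerDiv,
      fDiv_eq_top_of_not_ac (derivAtTop_hellingerFun_of_one_lt ha) hac, ENNReal.mul_top h0,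
      add_top]

/-- The **Rényi divergence of order `a`** between (probability) measures:
`D_a(μ ‖ ν) = (a - 1)⁻¹ · log ∫ p^a q^{1-a} dλ` for a simple order `a ∈ (0,1) ∪ (1,∞)` (computed in
`EReal` from `ENNReal.log` of the Hellinger integral and mapped back to `ℝ≥0∞`; for probability
measures the product is already `≥ 0`, and it is `∞` iff `μ ⟂ ν` (`a < 1`) resp. iff the Hellinger
integral is infinite (`a > 1`)), and `D_1 = klDiv` (the source defines `D_1` as `lim_{a ↑ 1} D_a`
and proves it equals the Kullback–Leibler divergence). Orders `a ≤ 0` and `a = ∞` are not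
covered (junk). [cite: VanervenHarremoes2014, Def. 2, Def. 3 and Thm. 5] -/
def renyiDiv (a : ℝ) (μ ν : Measure α) : ℝ≥0∞ :=
  if a = 1 then klDiv μ ν
  else (((a - 1)⁻¹ : ℝ) * ENNReal.log (hellingerIntegral a μ ν)).toENNReal

/-- At order `1` the Rényi divergence is the Kullback–Leibler divergence (by definition here;
a theorem in the source). [cite: VanervenHarremoes2014, Thm. 5] -/
@[simp] theorem renyiDiv_one (μ ν : Measure α) : renyiDiv 1 μ ν = klDiv μ ν := by
  simp [renyiDiv]

/-- Unfolding `renyiDiv` at a simple order. [cite: VanervenHarremoes2014, Def. 2] -/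
theorem renyiDiv_of_ne_one {a : ℝ} (ha : a ≠ 1) (μ ν : Measure α) :
    renyiDiv a μ ν = (((a - 1)⁻¹ : ℝ) * ENNReal.log (hellingerIntegral a μ ν)).toENNReal := by
  simp [renyiDiv, ha]

end Literature.Probability.Divergences
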